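import Mathlib
import Literature.Barriers.MatrixMultiplication.NormalizerBarrier

/-!
# Stub `stub_levelKVolumeShape` — line `ghost-calculus-chebotarev` of the crux
`SubgroupIdentityDesigns` (stmt-MatrixMultiplication-14079)

Crux
`Summit.MatrixMultiplication.MatrixMultiplication.Theses.LevelGradedCohnUmans.SubgroupIdentityDesigns`;
this file proves the registered NEGATIVE helper `stub_levelKVolumeShape` verbatim (name +
signature): the corner-faithful VOLUME SHAPE of a level-`k` sandwich design.  Pure group theory /
matrix bookkeeping / double counting, no Fourier analysis.

Setting.  `G = GL_m(𝔽_p)`, `k ≤ m`, three subgroups `H₁, H₂, H₃ ≤ G` with the subgroup triple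
product property (`Literature.Barriers.MatrixMultiplication.SubgroupTPP`).  Block conventions on
`Fin m`: the top-left block is `{i < k} × {j < k}`,
`U⁻ = {u : (u - 1) i j ≠ 0 → k ≤ i ∧ j < k}` (block lower-left unipotents),
`U⁺ = {v : (v - 1) i j ≠ 0 → i < k ∧ k ≤ j}`, `P⁻` = matrices with zero top-right block,
`P` = matrices with zero bottom-left block.  Hypotheses: `U⁻ ≤ H₁`, `U⁺ ≤ H₃`, `H₁ ≤ P⁻`,
`H₃ ≤ P`, and the outer SLICE property: a product `a g` (`a ∈ H₁`, `g ∈ H₃`) whose top-left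
block is the identity factors as `u v` with `u` of `U⁻`-shape and `v` of `U⁺`-shape.
Conclusion: `|H₁| |H₃| ≤ p^{k(m-k)} p^{k(m-k)} |GL_k(𝔽_p)|`.

Proof.  Let `T(M) = M.submatrix (Fin.castLE _) (Fin.castLE _)` be the top-left `k × k` block.
(1) `T` is multiplicative as soon as the left factor lies in `P⁻` or the right factor lies in
`P` (the cross terms of the block product vanish), so on `H₁` and on `H₃` it takes invertible
values (`T(h) T(h⁻¹) = T(1) = 1`).  (2) `Φ(h₁, h₃) := T(h₁) T(h₃)` maps `H₁ × H₃` into the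
image of `GL_k(𝔽_p)` in the `k × k` matrices.  (3) Fibres: `Φ(h₁, h₃) = Φ(h₁', h₃')` gives
`T(a g) = 1` for `a = h₁'⁻¹ h₁ ∈ H₁`, `g = h₃ h₃'⁻¹ ∈ H₃`; the slice yields `a g = u v`, so
`u⁻¹ a = v g⁻¹ ∈ H₁ ∩ H₃ = 1` (TPP), i.e. `h₁ = h₁' u`, `h₃ = v h₃'`: every fibre is covered
by `U⁻ × U⁺`, and `#U⁻, #U⁺ ≤ p^{k(m-k)}` by reading off the off-diagonal block.  (4) Double
counting: `|H₁ × H₃| ≤ #U⁻ #U⁺ |GL_k|`.  Sorry-free; standard axioms; no new definitions.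
-/

set_option linter.dupNamespace false

noncomputable section

open scoped BigOperators
open Literature.Barriers.MatrixMultiplication

namespace Summit.MatrixMultiplication.MatrixMultiplication.Theorems.SubgroupIdentityDesigns.Negative

namespace LevelKVolumeShape

/-! ## The top-left block `M.submatrix (Fin.castLE hkm) (Fin.castLE hkm)` on the parabolics -/

section TopLeft

variable {R : Type*} [CommRing R] {m k : ℕ}

/-- A sum over `Fin m` of a function vanishing at the indices `≥ k` is a sum over `Fin k`. -/
theorem sum_castLE (hkm : k ≤ m) (f : Fin m → R) (hf : ∀ l : Fin m, k ≤ l.val → f l = 0) :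
    ∑ l : Fin k, f (Fin.castLE hkm l) = ∑ l : Fin m, f l := by
  refine Fintype.sum_of_injective (Fin.castLE hkm) (Fin.castLE_injective hkm) _ _ ?_
    (fun _ => rfl)
  intro l hl
  apply hf
  by_contra hlt
  exact hl ⟨⟨l.val, Nat.lt_of_not_le hlt⟩, Fin.ext rfl⟩

/-- The top-left block is multiplicative as soon as the LEFT factor has zero top-right block
(`A ∈ P⁻`). -/
theorem submatrix_mul_of_left (hkm : k ≤ m) {A : Matrix (Fin m) (Fin m) R}
    (hA : ∀ i j : Fin m, i.val < k → k ≤ j.val → A i j = 0) (B : Matrix (Fin m) (Fin m) R) :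
    (A * B).submatrix (Fin.castLE hkm) (Fin.castLE hkm) =
      A.submatrix (Fin.castLE hkm) (Fin.castLE hkm) *
        B.submatrix (Fin.castLE hkm) (Fin.castLE hkm) := by
  ext i j
  simp only [Matrix.submatrix_apply, Matrix.mul_apply]
  symm
  apply sum_castLE hkm (fun l => A (Fin.castLE hkm i) l * B l (Fin.castLE hkm j))
  intro l hl
  rw [hA _ _ i.isLt hl, zero_mul]

/-- The top-left block is multiplicative as soon as the RIGHT factor has zero bottom-left block
(`B ∈ P`). -/
theorem submatrix_mul_of_right (hkm : k ≤ m) (A : Matrix (Fin m) (Fin m) R)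
    {B : Matrix (Fin m) (Fin m) R} (hB : ∀ i j : Fin m, k ≤ i.val → j.val < k → B i j = 0) :
    (A * B).submatrix (Fin.castLE hkm) (Fin.castLE hkm) =
      A.submatrix (Fin.castLE hkm) (Fin.castLE hkm) *
        B.submatrix (Fin.castLE hkm) (Fin.castLE hkm) := by
  ext i j
  simp only [Matrix.submatrix_apply, Matrix.mul_apply]
  symm
  apply sum_castLE hkm (fun l => A (Fin.castLE hkm i) l * B l (Fin.castLE hkm j))
  intro l hl
  rw [hB _ _ hl j.isLt, mul_zero]

/-- If the top-left block of `M` is `1` then the top-left block of `M - 1` vanishes (in `Fin m`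
coordinates). -/
theorem sub_one_apply_eq_zero (hkm : k ≤ m) {M : Matrix (Fin m) (Fin m) R}
    (h : M.submatrix (Fin.castLE hkm) (Fin.castLE hkm) = 1) (i j : Fin m) (hi : i.val < k)
    (hj : j.val < k) : (M - 1) i j = 0 := by
  have h1 := congr_fun (congr_fun h ⟨i.val, hi⟩) ⟨j.val, hj⟩
  simp only [Matrix.submatrix_apply, Fin.castLE_mk, Fin.eta, Matrix.one_apply,
    Fin.mk.injEq] at h1
  rw [Matrix.sub_apply, sub_eq_zero, h1, Matrix.one_apply]
  simp only [Fin.ext_iff]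

/-- Monoid bookkeeping for the fibre computation: `Aᵢ A' = 1`, `B' Bᵢ = 1` and `A B = A' B'`
give `Aᵢ A (B Bᵢ) = 1`. -/
theorem inv_mul_mul_mul_inv_eq_one {N : Type*} [Monoid N] {Ai A A' B B' Bi : N}
    (hA : Ai * A' = 1) (hB : B' * Bi = 1) (h : A * B = A' * B') : Ai * A * (B * Bi) = 1 := by
  calc Ai * A * (B * Bi) = Ai * (A * B) * Bi := by simp only [mul_assoc]
    _ = 1 := by rw [h, ← mul_assoc, hA, one_mul, hB]

end TopLeft

/-! ## Shapes: counting the two unipotent radicals from above -/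

section Shapes

variable {R : Type*} [CommRing R] {m : ℕ}

/-- Two matrices whose off-identity supports lie in `S` and which agree on `S` are equal. -/
theorem eq_of_agree_on_support {S : Fin m → Fin m → Prop} {u u' : Matrix (Fin m) (Fin m) R}
    (hu : ∀ i j, (u - 1) i j ≠ 0 → S i j) (hu' : ∀ i j, (u' - 1) i j ≠ 0 → S i j)
    (h : ∀ i j, S i j → u i j = u' i j) : u = u' := by
  ext i j
  by_cases hij : S i j
  · exact h i j hij
  · have e1 : u i j = (1 : Matrix (Fin m) (Fin m) R) i j := by
      by_contra hne
      exact hij (hu i j (by rwa [Matrix.sub_apply, sub_ne_zero]))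
    have e2 : u' i j = (1 : Matrix (Fin m) (Fin m) R) i j := by
      by_contra hne
      exact hij (hu' i j (by rwa [Matrix.sub_apply, sub_ne_zero]))
    rw [e1, e2]

variable (p m k : ℕ) [Fact p.Prime]

/-- `#U⁻ ≤ p^{k(m-k)}`: a `U⁻`-shaped unit is determined by its bottom-left block. -/
theorem card_lower_le (hkm : k ≤ m) :
    Nat.card {u : Matrix.GeneralLinearGroup (Fin m) (ZMod p) //
        ∀ i j : Fin m, ((u : Matrix (Fin m) (Fin m) (ZMod p)) - 1) i j ≠ 0 →
          k ≤ i.val ∧ j.val < k} ≤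
      p ^ (k * (m - k)) := by
  let e : {u : Matrix.GeneralLinearGroup (Fin m) (ZMod p) //
        ∀ i j : Fin m, ((u : Matrix (Fin m) (Fin m) (ZMod p)) - 1) i j ≠ 0 →
          k ≤ i.val ∧ j.val < k} →
      (Fin (m - k) → Fin k → ZMod p) :=
    fun u l i => (u.1 : Matrix (Fin m) (Fin m) (ZMod p))
      ⟨k + l.val, by have := l.isLt; omega⟩ (Fin.castLE hkm i)
  have he : Function.Injective e := by
    rintro ⟨u, hu⟩ ⟨u', hu'⟩ huu
    apply Subtype.ext
    apply Units.ext
    refine eq_of_agree_on_support hu hu' fun i j hij => ?_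
    have hi : (⟨k + (i.val - k), by omega⟩ : Fin m) = i := Fin.ext (by simp only; omega)
    have h1 : (u : Matrix (Fin m) (Fin m) (ZMod p)) ⟨k + (i.val - k), by omega⟩
        (Fin.castLE hkm ⟨j.val, hij.2⟩) = (u' : Matrix (Fin m) (Fin m) (ZMod p))
        ⟨k + (i.val - k), by omega⟩ (Fin.castLE hkm ⟨j.val, hij.2⟩) :=
      congr_fun (congr_fun huu ⟨i.val - k, by omega⟩) ⟨j.val, hij.2⟩
    simpa only [hi, Fin.castLE_mk, Fin.eta] using h1
  calc Nat.card _ ≤ Nat.card (Fin (m - k) → Fin k → ZMod p) := Nat.card_le_card_of_injective e he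
    _ = p ^ (k * (m - k)) := by
      rw [Nat.card_fun, Nat.card_fun, Nat.card_zmod, Nat.card_fin, Nat.card_fin, ← pow_mul]

/-- `#U⁺ ≤ p^{k(m-k)}`: a `U⁺`-shaped unit is determined by its top-right block. -/
theorem card_upper_le (hkm : k ≤ m) :
    Nat.card {v : Matrix.GeneralLinearGroup (Fin m) (ZMod p) //
        ∀ i j : Fin m, ((v : Matrix (Fin m) (Fin m) (ZMod p)) - 1) i j ≠ 0 →
          i.val < k ∧ k ≤ j.val} ≤
      p ^ (k * (m - k)) := by
  let e : {v : Matrix.GeneralLinearGroup (Fin m) (ZMod p) //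
        ∀ i j : Fin m, ((v : Matrix (Fin m) (Fin m) (ZMod p)) - 1) i j ≠ 0 →
          i.val < k ∧ k ≤ j.val} →
      (Fin (m - k) → Fin k → ZMod p) :=
    fun v l i => (v.1 : Matrix (Fin m) (Fin m) (ZMod p)) (Fin.castLE hkm i)
      ⟨k + l.val, by have := l.isLt; omega⟩
  have he : Function.Injective e := by
    rintro ⟨v, hv⟩ ⟨v', hv'⟩ hvv
    apply Subtype.ext
    apply Units.ext
    refine eq_of_agree_on_support hv hv' fun i j hij => ?_
    have hj : (⟨k + (j.val - k), by omega⟩ : Fin m) = j := Fin.ext (by simp only; omega)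
    have h1 : (v : Matrix (Fin m) (Fin m) (ZMod p)) (Fin.castLE hkm ⟨i.val, hij.1⟩)
        ⟨k + (j.val - k), by omega⟩ = (v' : Matrix (Fin m) (Fin m) (ZMod p))
        (Fin.castLE hkm ⟨i.val, hij.1⟩) ⟨k + (j.val - k), by omega⟩ :=
      congr_fun (congr_fun hvv ⟨j.val - k, by omega⟩) ⟨i.val, hij.1⟩
    simpa only [hj, Fin.castLE_mk, Fin.eta] using h1
  calc Nat.card _ ≤ Nat.card (Fin (m - k) → Fin k → ZMod p) := Nat.card_le_card_of_injective e he
    _ = p ^ (k * (m - k)) := by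
      rw [Nat.card_fun, Nat.card_fun, Nat.card_zmod, Nat.card_fin, Nat.card_fin, ← pow_mul]

end Shapes

/-! ## Abstract double counting -/

/-- Double counting: if `f : X → M` takes values in the image of `g : C → M` and every fibre of
`f` is covered by a copy of `W`, then `|X| ≤ |W| |C|`. -/
theorem card_le_of_fibres {X W C M : Type*} [Finite X] [Finite W] [Finite C]
    (f : X → M) (g : C → M) (himg : ∀ x, ∃ c, g c = f x)
    (φ : X → W → X) (hfib : ∀ x y, f x = f y → ∃ w, φ y w = x) :
    Nat.card X ≤ Nat.card W * Nat.card C := by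
  classical
  haveI := Fintype.ofFinite X
  haveI := Fintype.ofFinite W
  haveI := Fintype.ofFinite C
  rw [Nat.card_eq_fintype_card, Nat.card_eq_fintype_card, Nat.card_eq_fintype_card]
  have h1 : (Finset.univ : Finset X).card ≤ Fintype.card W * (Finset.univ.image f).card := by
    apply Finset.card_le_mul_card_image
    intro b hb
    obtain ⟨y, _, rfl⟩ := Finset.mem_image.mp hb
    calc (Finset.univ.filter (fun x => f x = f y)).card
        ≤ (Finset.univ.image (φ y)).card := by
          apply Finset.card_le_card
          intro x hx
          simp only [Finset.mem_filter, Finset.mem_univ, true_and] at hx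
          obtain ⟨w, hw⟩ := hfib x y hx
          exact Finset.mem_image.mpr ⟨w, Finset.mem_univ _, hw⟩
      _ ≤ Fintype.card W := Finset.card_image_le.trans (Finset.card_univ (α := W)).le
  have h2 : (Finset.univ.image f).card ≤ Fintype.card C := by
    calc (Finset.univ.image f).card ≤ (Finset.univ.image g).card := by
          apply Finset.card_le_card
          intro b hb
          obtain ⟨x, _, rfl⟩ := Finset.mem_image.mp hb
          obtain ⟨c, hc⟩ := himg x
          exact Finset.mem_image.mpr ⟨c, Finset.mem_univ _, hc⟩
      _ ≤ Fintype.card C := Finset.card_image_le.trans (Finset.card_univ (α := C)).le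
  calc Fintype.card X = (Finset.univ : Finset X).card := Finset.card_univ.symm
    _ ≤ Fintype.card W * (Finset.univ.image f).card := h1
    _ ≤ Fintype.card W * Fintype.card C := Nat.mul_le_mul_left _ h2

end LevelKVolumeShape

open LevelKVolumeShape in
/-- **Level-`k` corner-faithful volume shape** (negative helper for the line
`ghost-calculus-chebotarev` of the crux `SubgroupIdentityDesigns`).  In `GL_m(𝔽_p)`, `k ≤ m`,
let `H₁, H₂, H₃` satisfy the subgroup TPP, let `H₁` contain every `U⁻`-shaped unit and `H₃`
every `U⁺`-shaped unit, let `H₁ ≤ P⁻` (zero top-right block) and `H₃ ≤ P` (zero bottom-left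
block), and assume the outer SLICE property (a product `a g`, `a ∈ H₁`, `g ∈ H₃`, with identity
top-left block factors as `u v`, `u` of `U⁻`-shape, `v` of `U⁺`-shape).  Then
`|H₁| |H₃| ≤ p^{k(m-k)} p^{k(m-k)} |GL_k(𝔽_p)|`: the Levi decorations inject into `GL_k`. -/
theorem stub_levelKVolumeShape :
    ∀ (p : ℕ) [Fact p.Prime] (m k : ℕ), k ≤ m →
      ∀ (H₁ H₂ H₃ : Subgroup (Matrix.GeneralLinearGroup (Fin m) (ZMod p))),
      Literature.Barriers.MatrixMultiplication.SubgroupTPP H₁ H₂ H₃ →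
      (∀ u : Matrix.GeneralLinearGroup (Fin m) (ZMod p),
        (∀ i j : Fin m, ((u : Matrix (Fin m) (Fin m) (ZMod p)) - 1) i j ≠ 0 → k ≤ i.val ∧ j.val < k) →
          u ∈ H₁) →
      (∀ v : Matrix.GeneralLinearGroup (Fin m) (ZMod p),
        (∀ i j : Fin m, ((v : Matrix (Fin m) (Fin m) (ZMod p)) - 1) i j ≠ 0 → i.val < k ∧ k ≤ j.val) →
          v ∈ H₃) →
      (∀ h ∈ H₁, ∀ i j : Fin m, i.val < k → k ≤ j.val → (h : Matrix (Fin m) (Fin m) (ZMod p)) i j = 0) →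
      (∀ h ∈ H₃, ∀ i j : Fin m, k ≤ i.val → j.val < k → (h : Matrix (Fin m) (Fin m) (ZMod p)) i j = 0) →
      (∀ a ∈ H₁, ∀ g ∈ H₃,
        (∀ i j : Fin m, i.val < k → j.val < k →
          (((a * g : Matrix.GeneralLinearGroup (Fin m) (ZMod p)) : Matrix (Fin m) (Fin m) (ZMod p)) - 1)
            i j = 0) →
        ∃ u v : Matrix.GeneralLinearGroup (Fin m) (ZMod p),
          (∀ i j : Fin m, ((u : Matrix (Fin m) (Fin m) (ZMod p)) - 1) i j ≠ 0 → k ≤ i.val ∧ j.val < k) ∧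
          (∀ i j : Fin m, ((v : Matrix (Fin m) (Fin m) (ZMod p)) - 1) i j ≠ 0 → i.val < k ∧ k ≤ j.val) ∧
          a * g = u * v) →
      Nat.card H₁ * Nat.card H₃ ≤
        p ^ (k * (m - k)) * p ^ (k * (m - k)) * Nat.card (Matrix.GeneralLinearGroup (Fin k) (ZMod p)) := by
  intro p _ m k hkm H₁ H₂ H₃ htpp hL hR hP1 hP3 hslice
  -- (T0) `H₁ ∩ H₃ = 1`.
  have h13 : ∀ t, t ∈ H₁ → t ∈ H₃ → t = 1 := fun t h1 h3 =>
    (htpp t h1 1 H₂.one_mem t⁻¹ (H₃.inv_mem h3) (by simp)).1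
  -- (T1) block calculus: the top-left block `T` is multiplicative against `H₁` on the left and
  -- against `H₃` on the right, `T 1 = 1`, hence `T` takes invertible values on `H₁` and `H₃`.
  let T : Matrix (Fin m) (Fin m) (ZMod p) → Matrix (Fin k) (Fin k) (ZMod p) := fun M =>
    M.submatrix (Fin.castLE hkm) (Fin.castLE hkm)
  have hT1 : T 1 = 1 := Matrix.submatrix_one _ (Fin.castLE_injective hkm)
  have hmul1 : ∀ a ∈ H₁, ∀ M : Matrix (Fin m) (Fin m) (ZMod p),
      T ((a : Matrix (Fin m) (Fin m) (ZMod p)) * M) =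
        T (a : Matrix (Fin m) (Fin m) (ZMod p)) * T M :=
    fun a ha M => submatrix_mul_of_left hkm (hP1 a ha) M
  have hmul3 : ∀ M : Matrix (Fin m) (Fin m) (ZMod p), ∀ g ∈ H₃,
      T (M * (g : Matrix (Fin m) (Fin m) (ZMod p))) =
        T M * T (g : Matrix (Fin m) (Fin m) (ZMod p)) :=
    fun M g hg => submatrix_mul_of_right hkm M (hP3 g hg)
  have hinv1 : ∀ a ∈ H₁,
      T ((a⁻¹ : Matrix.GeneralLinearGroup (Fin m) (ZMod p)) : Matrix (Fin m) (Fin m) (ZMod p)) *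
        T (a : Matrix (Fin m) (Fin m) (ZMod p)) = 1 := by
    intro a ha
    rw [← hmul1 a⁻¹ (H₁.inv_mem ha), Units.inv_mul, hT1]
  have hinv1' : ∀ a ∈ H₁,
      T (a : Matrix (Fin m) (Fin m) (ZMod p)) *
        T ((a⁻¹ : Matrix.GeneralLinearGroup (Fin m) (ZMod p)) : Matrix (Fin m) (Fin m) (ZMod p))
          = 1 := by
    intro a ha
    rw [← hmul1 a ha, Units.mul_inv, hT1]
  have hinv3 : ∀ g ∈ H₃,
      T (g : Matrix (Fin m) (Fin m) (ZMod p)) *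
        T ((g⁻¹ : Matrix.GeneralLinearGroup (Fin m) (ZMod p)) : Matrix (Fin m) (Fin m) (ZMod p))
          = 1 := by
    intro g hg
    rw [← hmul3 _ g⁻¹ (H₃.inv_mem hg), Units.mul_inv, hT1]
  have hU1 : ∀ a ∈ H₁, IsUnit (T (a : Matrix (Fin m) (Fin m) (ZMod p))) :=
    fun a ha => IsUnit.of_mul_eq_one _ (hinv1' a ha)
  have hU3 : ∀ g ∈ H₃, IsUnit (T (g : Matrix (Fin m) (Fin m) (ZMod p))) :=
    fun g hg => IsUnit.of_mul_eq_one _ (hinv3 g hg)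
  -- (T2) the fibres of `Φ(h₁, h₃) = T h₁ * T h₃` are covered by `U⁻ × U⁺`.
  have hfib : ∀ h₁ ∈ H₁, ∀ h₃ ∈ H₃, ∀ h₁' ∈ H₁, ∀ h₃' ∈ H₃,
      T (h₁ : Matrix (Fin m) (Fin m) (ZMod p)) * T (h₃ : Matrix (Fin m) (Fin m) (ZMod p)) =
        T (h₁' : Matrix (Fin m) (Fin m) (ZMod p)) * T (h₃' : Matrix (Fin m) (Fin m) (ZMod p)) →
      ∃ u v : Matrix.GeneralLinearGroup (Fin m) (ZMod p),
        (∀ i j : Fin m, ((u : Matrix (Fin m) (Fin m) (ZMod p)) - 1) i j ≠ 0 →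
          k ≤ i.val ∧ j.val < k) ∧
        (∀ i j : Fin m, ((v : Matrix (Fin m) (Fin m) (ZMod p)) - 1) i j ≠ 0 →
          i.val < k ∧ k ≤ j.val) ∧
        h₁ = h₁' * u ∧ h₃ = v * h₃' := by
    intro h₁ hh₁ h₃ hh₃ h₁' hh₁' h₃' hh₃' heq
    have ha : h₁'⁻¹ * h₁ ∈ H₁ := H₁.mul_mem (H₁.inv_mem hh₁') hh₁
    have hg : h₃ * h₃'⁻¹ ∈ H₃ := H₃.mul_mem hh₃ (H₃.inv_mem hh₃')
    have hT : T (((h₁'⁻¹ * h₁) * (h₃ * h₃'⁻¹) : Matrix.GeneralLinearGroup (Fin m) (ZMod p)) :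
        Matrix (Fin m) (Fin m) (ZMod p)) = 1 := by
      rw [Units.val_mul, hmul1 _ ha, Units.val_mul, Units.val_mul, hmul1 _ (H₁.inv_mem hh₁'),
        hmul3 _ _ (H₃.inv_mem hh₃')]
      exact inv_mul_mul_mul_inv_eq_one (hinv1 _ hh₁') (hinv3 _ hh₃') heq
    obtain ⟨u, v, hu, hv, he⟩ := hslice _ ha _ hg
      (fun i j hi hj => sub_one_apply_eq_zero hkm hT i j hi hj)
    -- `u⁻¹ a = v g⁻¹ ∈ H₁ ∩ H₃ = 1`
    have ht : u⁻¹ * (h₁'⁻¹ * h₁) = v * (h₃ * h₃'⁻¹)⁻¹ := by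
      rw [eq_mul_inv_iff_mul_eq, mul_assoc, he, inv_mul_cancel_left]
    have ht1 : u⁻¹ * (h₁'⁻¹ * h₁) = 1 :=
      h13 _ (H₁.mul_mem (H₁.inv_mem (hL u hu)) ha)
        (ht ▸ H₃.mul_mem (hR v hv) (H₃.inv_mem hg))
    have hau : h₁'⁻¹ * h₁ = u := (inv_mul_eq_one.mp ht1).symm
    rw [ht1] at ht
    have hgv : h₃ * h₃'⁻¹ = v := (mul_inv_eq_one.mp ht.symm).symm
    refine ⟨u, v, hu, hv, ?_, ?_⟩
    · rw [← hau, mul_inv_cancel_left]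
    · rw [← hgv, inv_mul_cancel_right]
  -- (T3) double counting over `Φ : H₁ × H₃ → {k × k matrices}`.
  let W := {u : Matrix.GeneralLinearGroup (Fin m) (ZMod p) //
      ∀ i j : Fin m, ((u : Matrix (Fin m) (Fin m) (ZMod p)) - 1) i j ≠ 0 →
        k ≤ i.val ∧ j.val < k} ×
    {v : Matrix.GeneralLinearGroup (Fin m) (ZMod p) //
      ∀ i j : Fin m, ((v : Matrix (Fin m) (Fin m) (ZMod p)) - 1) i j ≠ 0 →
        i.val < k ∧ k ≤ j.val}
  let f : ↥H₁ × ↥H₃ → Matrix (Fin k) (Fin k) (ZMod p) := fun x =>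
    T ((x.1 : Matrix.GeneralLinearGroup (Fin m) (ZMod p)) : Matrix (Fin m) (Fin m) (ZMod p)) *
      T ((x.2 : Matrix.GeneralLinearGroup (Fin m) (ZMod p)) : Matrix (Fin m) (Fin m) (ZMod p))
  let φ : ↥H₁ × ↥H₃ → W → ↥H₁ × ↥H₃ := fun y w =>
    (⟨(y.1 : Matrix.GeneralLinearGroup (Fin m) (ZMod p)) * w.1.1,
        H₁.mul_mem y.1.2 (hL _ w.1.2)⟩,
      ⟨(w.2.1 : Matrix.GeneralLinearGroup (Fin m) (ZMod p)) * y.2,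
        H₃.mul_mem (hR _ w.2.2) y.2.2⟩)
  have key : Nat.card (↥H₁ × ↥H₃) ≤
      Nat.card W * Nat.card (Matrix.GeneralLinearGroup (Fin k) (ZMod p)) := by
    refine card_le_of_fibres f
      (fun c : Matrix.GeneralLinearGroup (Fin k) (ZMod p) => (c : Matrix (Fin k) (Fin k) (ZMod p)))
      (fun x => ?_) φ (fun x y hxy => ?_)
    · obtain ⟨c, hc⟩ := (hU1 _ x.1.2).mul (hU3 _ x.2.2)
      exact ⟨c, hc⟩
    · obtain ⟨u, v, hu, hv, hyu, hvy⟩ := hfib _ x.1.2 _ x.2.2 _ y.1.2 _ y.2.2 hxy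
      exact ⟨(⟨u, hu⟩, ⟨v, hv⟩), Prod.ext (Subtype.ext hyu.symm) (Subtype.ext hvy.symm)⟩
  have hW : Nat.card W ≤ p ^ (k * (m - k)) * p ^ (k * (m - k)) := by
    rw [Nat.card_prod]
    exact Nat.mul_le_mul (card_lower_le p m k hkm) (card_upper_le p m k hkm)
  calc Nat.card H₁ * Nat.card H₃ = Nat.card (↥H₁ × ↥H₃) := (Nat.card_prod _ _).symm
    _ ≤ Nat.card W * Nat.card (Matrix.GeneralLinearGroup (Fin k) (ZMod p)) := key
    _ ≤ p ^ (k * (m - k)) * p ^ (k * (m - k)) *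
          Nat.card (Matrix.GeneralLinearGroup (Fin k) (ZMod p)) := Nat.mul_le_mul_right _ hW

end Summit.MatrixMultiplication.MatrixMultiplication.Theorems.SubgroupIdentityDesigns.Negative
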